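import Literature.NumberTheory.Automorphic.QuaternionConjugacy
import Literature.NumberTheory.Automorphic.MatrixTwoConjugacy
import Mathlib.LinearAlgebra.Basis.VectorSpace
import Mathlib.RingTheory.TensorProduct.Free
import HarnessLib

/-!
# Trace and determinant of a rational element under a splitting `R ⊗_K D ≃ M₂(R)`

Topic `NumberTheory/Automorphic`; theorems only (no definition, no named fact, no instance).

Let `D` be a `K`-algebra, `R` a commutative `K`-algebra and `Ψ : R ⊗_K D ≃ₐ[R] M₂(R)`
*any* `R`-algebra isomorphism (a "splitting of `D` over `R`"; e.g. `𝔸_K^S ⊗_K D ≃ M₂(𝔸_K^S)` for a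
quaternion algebra unramified outside `S`, `QuaternionAdeleAwaySplitting`). For `x ∈ D ∖ K` satisfying
the quadratic relation `x² = t x - n` (`t, n ∈ K`; for a quaternion algebra `t = trd(x)`, `n = nrd(x)`,
`mul_self_eq_reducedTrace_mul_sub_reducedNorm`), the matrix `Ψ(1 ⊗ x)` has

  `tr Ψ(1 ⊗ x) = t` and `det Ψ(1 ⊗ x) = n` (in `R`)

(`ScalarExtension.trace_algEquiv_incl_eq`, `ScalarExtension.det_algEquiv_incl_eq`): `M = Ψ(1 ⊗ x)`
satisfies both `M² = t M - n` and Cayley–Hamilton `M² = tr(M) M - det(M)` (`matrixTwo_mul_self`), and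
`1, M` are `R`-linearly independent because `1 ⊗ 1, 1 ⊗ x` are
(`ScalarExtension.linearIndependent_one_incl`: `1, x` extend to a `K`-basis of `D`, which base-changes
to an `R`-basis of `R ⊗_K D`, Mathlib `Algebra.TensorProduct.basis`). No uniqueness of the splitting
(Skolem–Noether over rings) is needed.

Use: the element `Ψ(γ')` of `GL₂(𝔸_K^S)` attached to `γ' ∈ Dˣ` has the same characteristic polynomial
as the matching `γ ∈ GL₂(K)` (Gelbart (1975), §10, p. 154: the elliptic classes of `G'_F = Dˣ` and of
`G_F = GL₂(F)` are both indexed by the quadratic extensions), the first step of their conjugacy in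
`GL₂(𝔸_K^S)` in the comparison of the elliptic terms (p. 155). Part of the inline (D-0026)
decomposition of `Literature.NumberTheory.Automorphic.strong_multiplicity_one_quaternionUnits`.

## References

* S. Gelbart, *Automorphic forms on adele groups*, Ann. of Math. Studies 83 (1975), §10, pp. 154–155
  [Gelbart1975].
-/

noncomputable section

open scoped TensorProduct

namespace Literature.NumberTheory.Automorphic

namespace ScalarExtension

section Independent

variable (K : Type*) [Field K] (R : Type*) [CommRing R] [Algebra K R]
  (D : Type*) [Ring D] [Algebra K D]

/-- **`1 ⊗ 1` and `1 ⊗ x` are `R`-linearly independent in `R ⊗_K D` when `1, x` are `K`-linearly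
independent in `D`** (`1, x` extend to a `K`-basis of `D`, Mathlib `Basis.extend`, whose base change
`Algebra.TensorProduct.basis` is an `R`-basis of `R ⊗_K D` containing `1 ⊗ 1`, `1 ⊗ x`; Mathlib `Module.Basis.extend`). [folklore] -/
theorem linearIndependent_one_incl {x : D} (hx : LinearIndependent K ![(1 : D), x]) :
    LinearIndependent R ![(1 : ScalarExtension K R D), incl K R D x] := by
  classical
  have h01 : (1 : D) ≠ x := fun h => by
    have h' := hx.injective (a₁ := 0) (a₂ := 1) (by simp [h])
    exact absurd h' (by decide)
  have hs : LinearIndepOn K id (Set.range ![(1 : D), x]) := hx.linearIndepOn_id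
  set b := Module.Basis.extend hs with hb
  have h1mem : (1 : D) ∈ hs.extend (Set.subset_univ _) := Module.Basis.subset_extend hs ⟨0, rfl⟩
  have hxmem : x ∈ hs.extend (Set.subset_univ _) := Module.Basis.subset_extend hs ⟨1, rfl⟩
  set B := Algebra.TensorProduct.basis R b with hB
  let f : Fin 2 → hs.extend (Set.subset_univ _) := ![⟨1, h1mem⟩, ⟨x, hxmem⟩]
  have hf : Function.Injective f := by
    intro i j h
    fin_cases i <;> fin_cases j
    · rfl
    · exact absurd (congrArg Subtype.val h) h01
    · exact absurd (congrArg Subtype.val h).symm h01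
    · rfl
  have hind : LinearIndependent R (B ∘ f) := B.linearIndependent.comp f hf
  have heq : (![(1 : ScalarExtension K R D), incl K R D x] : Fin 2 → ScalarExtension K R D) = B ∘ f := by
    funext i
    fin_cases i
    · change (1 : ScalarExtension K R D) = B ⟨1, h1mem⟩
      rw [hB, Algebra.TensorProduct.basis_apply, hb, Module.Basis.extend_apply_self]
      rfl
    · change incl K R D x = B ⟨x, hxmem⟩
      rw [hB, Algebra.TensorProduct.basis_apply, hb, Module.Basis.extend_apply_self]
      rfl
  rw [heq]
  exact hind

end Independent

section TraceDet

variable (K : Type*) [Field K] (R : Type*) [CommRing R] [Algebra K R]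
  (D : Type*) [Ring D] [Algebra K D]

/-- **Trace and determinant of `Ψ(1 ⊗ x)` for any splitting `Ψ : R ⊗_K D ≃ₐ[R] M₂(R)`**: if
`x² = t x - n` in `D` (`t, n ∈ K`) and `1, x` are `K`-independent, then `tr Ψ(1 ⊗ x) = t` and
`det Ψ(1 ⊗ x) = n` — compare `M² = t M - n` with Cayley–Hamilton `M² = tr(M) M - det(M)` and use the
`R`-independence of `1, M`. [folklore] -/
theorem trace_det_algEquiv_incl_eq (Ψ : ScalarExtension K R D ≃ₐ[R] Matrix (Fin 2) (Fin 2) R) {x : D} {t n : K}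
    (hxx : x * x = algebraMap K D t * x - algebraMap K D n) (hx : LinearIndependent K ![(1 : D), x]) :
    (Ψ (incl K R D x)).trace = algebraMap K R t ∧ (Ψ (incl K R D x)).det = algebraMap K R n := by
  set M := Ψ (incl K R D x) with hM
  -- `M² = t M - n`
  have h1 : M * M = algebraMap K R t • M - algebraMap K R n • (1 : Matrix (Fin 2) (Fin 2) R) := by
    have h := congrArg (fun y : D => Ψ (incl K R D y)) hxx
    simp only [map_mul, map_sub] at h
    rw [h, hM]
    congr 1
    · rw [AlgHom.commutes, IsScalarTower.algebraMap_apply K R (ScalarExtension K R D), AlgEquiv.commutes,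
        Algebra.smul_def]
    · rw [AlgHom.commutes, IsScalarTower.algebraMap_apply K R (ScalarExtension K R D), AlgEquiv.commutes,
        Algebra.algebraMap_eq_smul_one]
  -- Cayley–Hamilton
  have h2 : M * M = M.trace • M - M.det • (1 : Matrix (Fin 2) (Fin 2) R) := matrixTwo_mul_self M
  -- independence of `1, M`
  have hind : LinearIndependent R ![(1 : Matrix (Fin 2) (Fin 2) R), M] := by
    have h := (linearIndependent_one_incl K R D hx).map' Ψ.toLinearEquiv.toLinearMap Ψ.toLinearEquiv.ker
    have heq : (Ψ.toLinearEquiv.toLinearMap : ScalarExtension K R D → Matrix (Fin 2) (Fin 2) R) ∘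
        ![(1 : ScalarExtension K R D), incl K R D x] = ![(1 : Matrix (Fin 2) (Fin 2) R), M] := by
      funext i
      fin_cases i
      · exact map_one Ψ
      · rfl
    rw [heq] at h
    exact h
  -- compare coefficients
  have hcomb : (M.det - algebraMap K R n) • (1 : Matrix (Fin 2) (Fin 2) R) + (algebraMap K R t - M.trace) • M = 0 := by
    have h3 : algebraMap K R t • M - algebraMap K R n • (1 : Matrix (Fin 2) (Fin 2) R) =
        M.trace • M - M.det • (1 : Matrix (Fin 2) (Fin 2) R) := by rw [← h1, ← h2]
    have h4 : algebraMap K R t • M - algebraMap K R n • (1 : Matrix (Fin 2) (Fin 2) R) -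
        (M.trace • M - M.det • (1 : Matrix (Fin 2) (Fin 2) R)) = 0 := sub_eq_zero.2 h3
    rw [sub_smul, sub_smul, ← h4]
    abel
  obtain ⟨hd, ht⟩ := (LinearIndependent.pair_iff.1 hind) _ _ hcomb
  exact ⟨(sub_eq_zero.1 ht).symm, sub_eq_zero.1 hd⟩

/-- `tr Ψ(1 ⊗ x) = t`. [folklore] -/
theorem trace_algEquiv_incl_eq (Ψ : ScalarExtension K R D ≃ₐ[R] Matrix (Fin 2) (Fin 2) R) {x : D} {t n : K}
    (hxx : x * x = algebraMap K D t * x - algebraMap K D n) (hx : LinearIndependent K ![(1 : D), x]) :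
    (Ψ (incl K R D x)).trace = algebraMap K R t :=
  (trace_det_algEquiv_incl_eq K R D Ψ hxx hx).1

/-- `det Ψ(1 ⊗ x) = n`. [folklore] -/
theorem det_algEquiv_incl_eq (Ψ : ScalarExtension K R D ≃ₐ[R] Matrix (Fin 2) (Fin 2) R) {x : D} {t n : K}
    (hxx : x * x = algebraMap K D t * x - algebraMap K D n) (hx : LinearIndependent K ![(1 : D), x]) :
    (Ψ (incl K R D x)).det = algebraMap K R n :=
  (trace_det_algEquiv_incl_eq K R D Ψ hxx hx).2

/-- **Quaternion algebras**: for `x ∈ D` with `1, x` independent (i.e. `x ∉ K`), any splitting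
`Ψ : R ⊗_K D ≃ₐ[R] M₂(R)` gives `tr Ψ(1 ⊗ x) = trd(x)` and `det Ψ(1 ⊗ x) = nrd(x)`
(`mul_self_eq_reducedTrace_mul_sub_reducedNorm`). [folklore] -/
theorem trace_det_algEquiv_incl_eq_reduced [CharZero K] [IsQuaternionAlgebra K D]
    (Ψ : ScalarExtension K R D ≃ₐ[R] Matrix (Fin 2) (Fin 2) R) {x : D} (hx : LinearIndependent K ![(1 : D), x]) :
    (Ψ (incl K R D x)).trace = algebraMap K R (reducedTrace K D x) ∧
      (Ψ (incl K R D x)).det = algebraMap K R (reducedNorm K D x) :=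
  trace_det_algEquiv_incl_eq K R D Ψ (mul_self_eq_reducedTrace_mul_sub_reducedNorm K D x) hx

end TraceDet

end ScalarExtension

end Literature.NumberTheory.Automorphic
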